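import Literature.NumberTheory.LFunctions.DeBruijnNewman
import Literature.Barriers.RiemannHypothesis.NewmanConjectureProofs
import HarnessLib

/-!
# T-candidate «NEAR-FIELD NEWMAN» (β ≥ 0 ?) — typed statement for lead g9 (director-rh GO 22:59:32Z (4))

Seat rh-idea-2 g2 (D-0145; column DBN / Laguerre–Pólya).  RH-FREE OPEN QUESTION owned by the column; NOT a line,
NOT an item of any `closes` cone (BN-1: flow pieces are RH-strength); a T-number candidate + one METER (U) datum.

Backward heat flow: `H_t = deBruijnH t`, `∂_t H_t = −∂_z² H_t`; for `t < 0`, `H_t` is NOT hyperbolic (Rodgers–Tao 2020,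
tree `rodgers_tao_holds` / `not_hasOnlyRealZeros_deBruijnH_of_neg`).  Non-hyperbolicity of a real even entire function of
order < 2 can show on the REAL AXIS in two ways: (N) a NON-CROSSING DIP — a real critical point `c` of `Re H_t|ℝ`, off the
zeros, with the wrong Laguerre sign `H_t(c)·H_t″(c) ≥ 0` (the shadow of a complex pair in final approach, cf. item
stmt-RiemannHypothesis-23303 `DipInJensenDisc` at `t = 0`); (F) only in the FAR FIELD — all dips still cross, and the
defect is carried by complex zeros far from landing / by zeros of `H_t′` off the axis.  Define
`β := sup {t : H_t has a non-crossing dip}` and `β_L := sup {t : the Laguerre inequality (H_t′)² ≥ H_t H_t″ fails somewhere on ℝ}`;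
then `β ≤ β_L ≤ Λ` and (BN-1, RH-free) `Λ = max(λ₁, β) = max(λ₁, β_L)` where `λ₁ := Λ(H₀′)`-type far-field constant
(`JensenX4NewmanDeriv.newmanDeriv`: `λ₁ ≥ 0`).  KNOWN: `Λ ≥ 0` (Rodgers–Tao) and `λ₁ ≥ 0`, so NEITHER `β ≥ 0` NOR `β < 0` is forced;
`β_L > −0.0991` is in print (Csordas–Ruttan–Varga 1991, Numer. Algorithms 1: a Laguerre-difference violation of `H_λ` at
`λ = −0.0991` — their route to `Λ > −0.0991`), and every Lehmer-pair collision time `t* < 0` (CSV 1994) gives `β ≥ t*`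
heuristically (just below `t*` the collided pair is complex and shadows a non-crossing dip) — the best printed collision
bound is `t* > −1.15·10⁻¹¹` (Saouter–Gourdon–Demichel 2011), so `β ≥ −1.15·10⁻¹¹` is the expected certified floor, and
`β ≥ 0` ⟺ «there are non-crossing dips at times arbitrarily close to 0⁻» (e.g. infinitely many ever-stronger Lehmer
collisions — open; Rodgers–Tao's proof of `Λ ≥ 0` does NOT produce them).

QUESTION (T-candidate): `NearFieldNewman` below (β ≥ 0 in the strong pointwise form «every t < 0 has a dip»).  Weak
form: `LaguerreDifferenceNewman` (β_L ≥ 0).  `NearFieldNewman → LaguerreDifferenceNewman` (proved below, 5 lines).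
READING OF METER (U) «DBN-BACKWARD-DIP» (pre-stated, director 22:59:32Z): on the grid `t ∈ {−0.5, −0.4, −0.3, −0.2, −0.1, −0.05}`
at the Lehman site `x ≈ 143465.8` (z-coordinates; ζ-height 71732.9): «β ≥ t_max-consistent» iff a non-crossing dip of
`H_t` is found (design-grade) / certified at some grid `t` (then `β ≥ that t` is an (i)-class record on this T-item);
«β<0-evidence» is NOT obtainable from a finite x-window (absence of dips near one site says nothing globally) — the
run therefore ALSO records the DICTIONARY ROW `d(t)/κ(t)` (dip depth / curvature) against the collision normal form
`a[(z−c)² + 2(t*−t)]`, which predicts `d/κ = t* − t` exactly; agreement within 10 % on the grid = «dictionary consistent»,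
else «dictionary fails at the Lehman site» (either is a record about the instrument, never RH-evidence).
Nothing here bears on the truth of RH.
-/

noncomputable section

set_option linter.dupNamespace false

namespace Summit.RiemannHypothesis.RiemannHypothesis.Cruxes.DBN.NearFieldNewman

open Literature.NumberTheory.LFunctions

/-- **T-candidate «NEAR-FIELD NEWMAN» (β ≥ 0, strong form).** For every `t < 0` the de Bruijn function `H_t` has a
NON-CROSSING DIP on the real axis: a real critical point `c` of `u ↦ Re H_t(u)`, off the zeros of `H_t`, at which the
Laguerre sign is wrong, `H_t(c)·H_t″(c) ≥ 0`.  RH-free; open; neither it nor its negation follows from `Λ ≥ 0`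
(BN-1: `Λ = max(λ₁, β)` with `λ₁ ≥ 0` known).  Owner: DBN column (rh-idea-2 g2); T-number to be assigned by lead g9. -/
def NearFieldNewman : Prop :=
  ∀ t : ℝ, t < 0 →
    ∃ c : ℝ, deriv (fun u : ℝ => (deBruijnH t (u : ℂ)).re) c = 0 ∧ (deBruijnH t (c : ℂ)).re ≠ 0 ∧
      0 ≤ (deBruijnH t (c : ℂ)).re * iteratedDeriv 2 (fun u : ℝ => (deBruijnH t (u : ℂ)).re) c

/-- **Weak form (β_L ≥ 0): the Laguerre inequality fails somewhere on ℝ for every `t < 0`.**  This is the quantity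
Csordas–Ruttan–Varga 1991 certified at `t = −0.0991` (so `β_L > −0.0991` is in print); `β_L ≥ 0` is open. -/
def LaguerreDifferenceNewman : Prop :=
  ∀ t : ℝ, t < 0 →
    ∃ x : ℝ, deriv (fun u : ℝ => (deBruijnH t (u : ℂ)).re) x ^ 2 ≤
      (deBruijnH t (x : ℂ)).re * iteratedDeriv 2 (fun u : ℝ => (deBruijnH t (u : ℂ)).re) x

/-- Strong ⟹ weak: at a non-crossing dip the Laguerre difference `(H′)² − H H″ = −H H″ ≤ 0`. -/
theorem laguerreDifferenceNewman_of_nearFieldNewman (h : NearFieldNewman) : LaguerreDifferenceNewman := by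
  intro t ht
  obtain ⟨c, hc1, _, hc2⟩ := h t ht
  exact ⟨c, by rw [hc1]; simpa using hc2⟩

/-- Sanity (tree): for `t < 0`, `H_t` is not hyperbolic (Rodgers–Tao) — the far/near dichotomy above is about HOW. -/
theorem not_hyperbolic_of_neg {t : ℝ} (ht : t < 0) : ¬ HasOnlyRealZeros (deBruijnH t) :=
  Literature.Barriers.RiemannHypothesis.not_hasOnlyRealZeros_deBruijnH_of_neg ht

end Summit.RiemannHypothesis.RiemannHypothesis.Cruxes.DBN.NearFieldNewman

end
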